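import Summits.QuantumFields.YangMills.Theorems.FluctuationComparisonRegPrIntLPolymerMayerGas
import HarnessLib

/-!
# THE LAST MAYER STEP ON T³ — JOINT-PARAMETER EDITION: terms complex-differentiable on ANY complex normed parameter space

Cell `ym3-torus` (YM ladder rung R3 = continuum `SU(2)` Yang–Mills on the three-torus — a RUNG, NOT d = 4, NOT infinite volume, NOT a mass gap, NOT Clay).  Width seat
`ym-ust-20520-w3` (gen 21, LEAD-20520 by lineage); `--supports stmt-QuantumFields-20520 --as helper`, count-neutral, definition-free, default heartbeats.

WHAT THIS IS.  ✓`…PolymerMayerGas.exists_localized_log_gas` (gen 20, (E)) and its families edition ✓`…PolymerMayerGasFamilies.exists_localized_log_gas_families` (I′)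
deliver the (2.13)-localized terms `T Y := Re E(Y)` of `log Ξ` for the `TTouch`-gas of face-connected cube polymers of `TPt 3 N` with analytic interpolations ALONG ONE OR
TWO COMPLEX LINES only.  LINE g24-4 «background form» v2 ANALYTIC EDITION (w5-20520 g20's BGFORMᵃ∘ v2) asks instead for terms `𝒯 X` that are
`DifferentiableOn ℂ` JOINTLY on an open set of a finite-dimensional complex register space (`({e ∕∕ blk e ∈ X} → (Fin 8 → ℂ))`).  The Summits face
✓`…Spine.NE1p.DressedOutputAnalyticFaces.analytic_and_bounded_locE_param_of_geometry` is stated for a parameter in ANY complex normed space `P`, so the Mayer step has a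
JOINT-PARAMETER edition at no extra cost; this file is that edition, with the activities a FIELD `act : P → TDom 3 N → ℂ` over `P`:

* §1 (the clauses, for the EXPLICIT witness `𝒯 Y p := E_{act p}(Y) = locE TTouch (·.1) (act p) Y`):
  `locE_param_congr` (LOCALITY: `𝒯 Y p` depends on `act p Z` for `Z ⊆ Y` only), `differentiableOn_locE_param_tthree` ∕ `norm_locE_param_le_tthree` (JOINT holomorphy on an
  open `U ⊆ P` where the activities are holomorphic with the majorant `A·e^{−R·d(Z)}`, and the (2.41) envelope `e·ν·c₁·K₀²·A·e^{−r₁·d(Y)}` there),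
  `locE_param_eq_zero_of_not_tFaceConnected` (support), `locE_param_real` (realness, positivity of `Ξ` and `log Re Ξ = Σ_Y Re 𝒯 Y` at every parameter with REAL activities);
* §2 ★★★ `exists_localized_log_gas_param` — the five clauses bundled as one `∃ 𝒯 : Finset (TPt 3 N) → P → ℂ` statement in the style of (E), for docking.

USE (next file of this seat, (GASᵛ²)): with `P :=` the complexified register space of the blocks of a coarse cell and `act p Z :=` Bałaban's small-field ∕ `R′`-activities read as
holomorphic functions of the background registers ([Balaban1987RG1] (1.11)–(1.14) p.262), §2 gives BGFORMᵃ∘ v2's `DifferentiableOn ℂ (𝒯 X) (Dom X)`, the sup bound `Bx X`, and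
the representation through `Re 𝒯 X` at real registers BY NAME.  That knit is NOT in this file.

HONEST: an abstract theorem about polymer gases on `tsys 3 N`; no Bałaban density, action or renormalisation map appears; nothing of Bałaban's is asserted; BGFORM∘ v2,
BGFORMᵃ∘ v2, BAL-GAS∘, POLYᵃ∘, S2β, `FluctuationComparisonRegPrIntL` (20520) and `YM3TorusSU2` are NOT proved; registry v11.4 and its five stubs untouched (0∕5).
[cite: Balaban1988RG2Cluster, (2.11)-(2.13) p.14 and (2.41) p.21; KoteckyPreiss1986, Theorem p.492 and p.493; Balaban1987RG1, (1.11)-(1.14) p.262]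
-/

set_option autoImplicit false

noncomputable section

namespace Summit.QuantumFields.YangMills.Theorems.FluctuationComparisonRegPrIntLPolymerMayerGasParam

open scoped BigOperators
open Literature.MathematicalPhysics.QuantumFieldTheory.Balaban1983to89 (LocDomainSys)
open Literature.MathematicalPhysics.QuantumFieldTheory.Balaban1983to89.TreeLengthTorus (TPt TDom IsTDom tsys TFaceConnected torusTreeLen torusTreeLen_nonneg)
open Literature.MathematicalPhysics.QuantumFieldTheory.Balaban1983to89.TreeLengthTorusGeometry (TTouch tgeometry ttouch_refl ttouch_symm)
open Literature.MathematicalPhysics.QuantumFieldTheory.Balaban1983to89.B13Resummation (locE locE_congr)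
open Literature.Probability.LatticeModels
open Summit.QuantumFields.BalabanUV.T4Continuum.NE1p.DressedOutputAnalyticFaces (analytic_and_bounded_locE_param_of_geometry)
open Summit.QuantumFields.YangMills.Theorems.FluctuationComparisonRegPrIntLPolymerMayerGas

variable {N : ℕ} [NeZero N]
variable {P : Type*} [NormedAddCommGroup P] [NormedSpace ℂ P]

/-! ## §1 The clauses for the explicit witness `𝒯 Y p := E_{act p}(Y)` -/

open Classical in
/-- **LOCALITY IN THE PARAMETER THROUGH THE ACTIVITIES**: if two parameters give the same activity to every polymer `Z ⊆ Y`, they give the same localized term `E(Y)`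
(lit ✓`B13Resummation.locE_congr`: «Z̃₀ ⊂ Z ⊂ X for the activities in (2.13)»). [cite: Balaban1988RG2Cluster, (2.13) p.14] -/
theorem locE_param_congr {P : Type*} (act : P → TDom 3 N → ℂ) (Y : Finset (TPt 3 N)) {p p' : P}
    (h : ∀ Z : TDom 3 N, Z.1 ⊆ Y → act p Z = act p' Z) :
    locE TTouch (fun Z : TDom 3 N => Z.1) (act p) Y = locE TTouch (fun Z : TDom 3 N => Z.1) (act p') Y :=
  locE_congr TTouch fun Z hZ => h Z hZ

open Classical in
/-- ★★ **JOINT HOLOMORPHY OF `p ↦ E_{act p}(Y)` ON ANY COMPLEX NORMED PARAMETER SPACE** in the printed regime `r₁ + 2κ₀ + 2 ≤ R`, `A·e^{5r₁+1}·K₀·ν·c₁ ≤ 1` of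
`tgeometry 3 N`: activities holomorphic on an open `U ⊆ P` with the majorant `A·e^{−R·d(Z)}` there ⟹ `DifferentiableOn ℂ (p ↦ E_{act p}(Y)) U` (the Summits face
✓`analytic_and_bounded_locE_param_of_geometry`, parameter space `P`, for a non-empty face-connected `Y`; for any other `Y` the term VANISHES identically on `U`
(Kotecký–Preiss from the majorant, ✓`…PolymerMayerGas.locE_eq_zero_of_not_isTDom`), so it is differentiable there as well). [cite: Balaban1988RG2Cluster, (2.41) p.21; KoteckyPreiss1986, p.493] -/
theorem differentiableOn_locE_param_tthree (act : P → TDom 3 N → ℂ) {U : Set P} (hU : IsOpen U) {A R r₁ : ℝ} (hA : 0 ≤ A) (hr₁ : 0 ≤ r₁)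
    (hrate : r₁ + 2 * (tgeometry 3 N).κ₀ + 2 ≤ R)
    (hsmall : A * Real.exp (5 * r₁ + 1) * (tgeometry 3 N).K₀ * (tgeometry 3 N).ν * (tgeometry 3 N).c₁ ≤ 1)
    (hhol : ∀ Z : TDom 3 N, DifferentiableOn ℂ (fun p => act p Z) U)
    (hbound : ∀ p ∈ U, ∀ Z : TDom 3 N, ‖act p Z‖ ≤ A * Real.exp (-(R * torusTreeLen Z.1)))
    (Y : Finset (TPt 3 N)) :
    DifferentiableOn ℂ (fun p => locE TTouch (fun Z : TDom 3 N => Z.1) (act p) Y) U := by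
  haveI : Std.Refl (TTouch (d := 3) (N := N)) := ⟨ttouch_refl⟩
  haveI : Std.Symm (TTouch (d := 3) (N := N)) := ⟨ttouch_symm⟩
  by_cases hY : IsTDom Y
  · -- a non-empty face-connected `Y` is a domain `X₀` of `tsys 3 N`; the face gives holomorphy on `U`
    set X₀ : TDom 3 N := ⟨Y, hY.1, hY.2⟩ with hX₀
    have hface := analytic_and_bounded_locE_param_of_geometry (tgeometry 3 N) (m := fun Z => A * Real.exp (-(R * (tsys 3 N).dj Z)))
      (act := act) (A := A) (R := R) (r₁ := r₁) X₀ (U := U) hU hA hr₁ hrate hsmall (fun Z _ => hhol Z)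
      (fun p hp Z _ => hbound p hp Z) (fun Z _ => le_rfl)
    exact hface.1
  · -- otherwise `E_{act p}(Y) = 0` for every `p ∈ U` (KP from the majorant): a function vanishing on the open set is differentiable there
    have hzero : ∀ p ∈ U, locE TTouch (fun Z : TDom 3 N => Z.1) (act p) Y = 0 := fun p hp =>
      locE_eq_zero_of_not_isTDom (isKPVolume_tgeometry (N := N) (w := act p) hA hr₁ hrate hsmall (hbound p hp)) hY
    exact (differentiableOn_const (0 : ℂ)).congr hzero

open Classical in
/-- ★★ **THE (2.41) ENVELOPE, UNIFORMLY ON THE PARAMETER SET**: for `p ∈ U`, `‖E_{act p}(Y)‖ ≤ e·ν·c₁·K₀²·A·e^{−r₁·d(Y)}` (`d = torusTreeLen`; written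
`Real.exp (-r₁ * d)`, POLYᵃ∘'s currency); for `Y` not a non-empty face-connected polymer the term vanishes. [cite: Balaban1988RG2Cluster, (2.41) p.21] -/
theorem norm_locE_param_le_tthree (act : P → TDom 3 N → ℂ) {U : Set P} (hU : IsOpen U) {A R r₁ : ℝ} (hA : 0 ≤ A) (hr₁ : 0 ≤ r₁)
    (hrate : r₁ + 2 * (tgeometry 3 N).κ₀ + 2 ≤ R)
    (hsmall : A * Real.exp (5 * r₁ + 1) * (tgeometry 3 N).K₀ * (tgeometry 3 N).ν * (tgeometry 3 N).c₁ ≤ 1)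
    (hhol : ∀ Z : TDom 3 N, DifferentiableOn ℂ (fun p => act p Z) U)
    (hbound : ∀ p ∈ U, ∀ Z : TDom 3 N, ‖act p Z‖ ≤ A * Real.exp (-(R * torusTreeLen Z.1)))
    (Y : Finset (TPt 3 N)) {p : P} (hp : p ∈ U) :
    ‖locE TTouch (fun Z : TDom 3 N => Z.1) (act p) Y‖ ≤
      Real.exp 1 * (tgeometry 3 N).ν * (tgeometry 3 N).c₁ * (tgeometry 3 N).K₀ ^ 2 * A * Real.exp (-r₁ * torusTreeLen Y) := by
  haveI : Std.Refl (TTouch (d := 3) (N := N)) := ⟨ttouch_refl⟩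
  haveI : Std.Symm (TTouch (d := 3) (N := N)) := ⟨ttouch_symm⟩
  have hK₀ : 0 ≤ (tgeometry 3 N).K₀ := (tgeometry 3 N).K₀_nonneg
  have hν : 0 ≤ (tgeometry 3 N).ν := (tgeometry 3 N).ν_nonneg
  have hc₁ : 0 ≤ (tgeometry 3 N).c₁ := (tgeometry 3 N).c₁_nonneg
  by_cases hY : IsTDom Y
  · set X₀ : TDom 3 N := ⟨Y, hY.1, hY.2⟩ with hX₀
    have hface := analytic_and_bounded_locE_param_of_geometry (tgeometry 3 N) (m := fun Z => A * Real.exp (-(R * (tsys 3 N).dj Z)))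
      (act := act) (A := A) (R := R) (r₁ := r₁) X₀ (U := U) hU hA hr₁ hrate hsmall (fun Z _ => hhol Z)
      (fun p hp Z _ => hbound p hp Z) (fun Z _ => le_rfl)
    rw [neg_mul]
    exact hface.2 p hp
  · have hzero : locE TTouch (fun Z : TDom 3 N => Z.1) (act p) Y = 0 :=
      locE_eq_zero_of_not_isTDom (isKPVolume_tgeometry (N := N) (w := act p) hA hr₁ hrate hsmall (hbound p hp)) hY
    rw [hzero, norm_zero]
    positivity

omit [NormedAddCommGroup P] [NormedSpace ℂ P] in
open Classical in
/-- **SUPPORT**: at a parameter where the activities obey the majorant (hence KP), `E_{act p}(Y) = 0` unless `Y` is (non-empty and) torus-face-connected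
(✓`…PolymerMayerGas.locE_eq_zero_of_not_isTDom`). [cite: Balaban1988RG2Cluster, (2.13) p.14 and (2.27) p.18] -/
theorem locE_param_eq_zero_of_not_tFaceConnected (act : P → TDom 3 N → ℂ) {A R r₁ : ℝ} (hA : 0 ≤ A) (hr₁ : 0 ≤ r₁)
    (hrate : r₁ + 2 * (tgeometry 3 N).κ₀ + 2 ≤ R)
    (hsmall : A * Real.exp (5 * r₁ + 1) * (tgeometry 3 N).K₀ * (tgeometry 3 N).ν * (tgeometry 3 N).c₁ ≤ 1)
    {p : P} (hbound : ∀ Z : TDom 3 N, ‖act p Z‖ ≤ A * Real.exp (-(R * torusTreeLen Z.1)))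
    {Y : Finset (TPt 3 N)} (hY : ¬ TFaceConnected Y) :
    locE TTouch (fun Z : TDom 3 N => Z.1) (act p) Y = 0 :=
  locE_eq_zero_of_not_isTDom (isKPVolume_tgeometry (N := N) (w := act p) hA hr₁ hrate hsmall hbound) fun h => hY h.2

omit [NormedAddCommGroup P] [NormedSpace ℂ P] in
open Classical in
/-- ★★ **AT A PARAMETER WITH REAL ACTIVITIES: every `E_{act p}(Y)` is real, `Re Ξ > 0`, and `log Re Ξ = Σ_Y Re E_{act p}(Y)`** (✓`…PolymerMayerGas.locE_im_eq_zero` +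
✓`log_re_ppf_eq_sum_re_locE`, at the KP volume of the majorant).  This is the REPRESENTATION clause of BGFORMᵃ∘ v2 read «through `Re 𝒯 X` at the real embedding of the
registers». [cite: Balaban1988RG2Cluster, (2.11)-(2.13) p.14; KoteckyPreiss1986, Theorem p.492] -/
theorem locE_param_real (act : P → TDom 3 N → ℂ) {A R r₁ : ℝ} (hA : 0 ≤ A) (hr₁ : 0 ≤ r₁)
    (hrate : r₁ + 2 * (tgeometry 3 N).κ₀ + 2 ≤ R)
    (hsmall : A * Real.exp (5 * r₁ + 1) * (tgeometry 3 N).K₀ * (tgeometry 3 N).ν * (tgeometry 3 N).c₁ ≤ 1)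
    {p : P} (hbound : ∀ Z : TDom 3 N, ‖act p Z‖ ≤ A * Real.exp (-(R * torusTreeLen Z.1))) (hreal : ∀ Z : TDom 3 N, (act p Z).im = 0) :
    (∀ Y : Finset (TPt 3 N), (locE TTouch (fun Z : TDom 3 N => Z.1) (act p) Y).im = 0) ∧
      0 < (polymerPartitionFunction TTouch (act p) (Finset.univ : Finset (TDom 3 N))).re ∧
      Real.log (polymerPartitionFunction TTouch (act p) (Finset.univ : Finset (TDom 3 N))).re =
        ∑ Y : Finset (TPt 3 N), (locE TTouch (fun Z : TDom 3 N => Z.1) (act p) Y).re := by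
  have hKP := isKPVolume_tgeometry (N := N) (w := act p) hA hr₁ hrate hsmall hbound
  obtain ⟨hpos, hlog⟩ := log_re_ppf_eq_sum_re_locE (N := N) (w := act p) hA hr₁ hrate hsmall hbound hreal
  exact ⟨fun Y => locE_im_eq_zero hKP hreal Y, hpos, hlog⟩

/-! ## §2 The theorem (bundled, (E)-style) -/

open Classical in
/-- ★★★ **THE LAST MAYER STEP ON T³ — JOINT-PARAMETER EDITION.**  Polymers = non-empty torus-face-connected cube sets of `TPt 3 N` (lit `tsys 3 N`), hard core = touching
(lit `TTouch`).  For an activity FIELD `act : P → TDom 3 N → ℂ` over ANY complex normed space `P`, activity-wise complex-differentiable on an OPEN `U ⊆ P` and obeying the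
majorant `‖act p Z‖ ≤ A·e^{−R·d(Z)}` there, in the printed regime `r₁ + 2κ₀ + 2 ≤ R`, `A·e^{5r₁+1}·K₀·ν·c₁ ≤ 1` (d = 3 constants of `tgeometry 3 N`), there is
`𝒯 : Finset (TPt 3 N) → P → ℂ` — the witness is `𝒯 Y p := E_{act p}(Y)`, the (2.13) localization of `log Ξ(act p)` — with
(i) LOCALITY: `𝒯 Y p = 𝒯 Y p'` whenever `act p Z = act p' Z` for all `Z ⊆ Y` (ALL `p p'`, no membership in `U` needed);
(ii) SUPPORT: for `p ∈ U`, `𝒯 Y p = 0` unless `Y` is torus-face-connected;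
(iii) JOINT HOLOMORPHY: `DifferentiableOn ℂ (𝒯 Y) U` for every `Y`;
(iv) ENVELOPE: `‖𝒯 Y p‖ ≤ e·ν·c₁·K₀²·A·e^{−r₁·d(Y)}` for `p ∈ U` (written `Real.exp (-r₁ * torusTreeLen Y)`);
(v) REAL POINTS: for `p ∈ U` with every `act p Z` real — every `𝒯 Y p` is real, `0 < Re Ξ(act p)` and `Real.log (Re Ξ(act p)) = Σ_Y Re 𝒯 Y p`.
This is the currency of an analytic background-form row whose terms must be holomorphic JOINTLY in a finite-dimensional register vector (BGFORMᵃ∘ v2), which the one-∕two-line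
families of (E)∕(I′) do not give. [cite: Balaban1988RG2Cluster, (2.11)-(2.13) p.14 and (2.41) p.21; KoteckyPreiss1986, Theorem p.492 and p.493; Balaban1987RG1, (1.11)-(1.14) p.262] -/
theorem exists_localized_log_gas_param (act : P → TDom 3 N → ℂ) {U : Set P} (hU : IsOpen U) {A R r₁ : ℝ} (hA : 0 ≤ A) (hr₁ : 0 ≤ r₁)
    (hrate : r₁ + 2 * (tgeometry 3 N).κ₀ + 2 ≤ R)
    (hsmall : A * Real.exp (5 * r₁ + 1) * (tgeometry 3 N).K₀ * (tgeometry 3 N).ν * (tgeometry 3 N).c₁ ≤ 1)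
    (hhol : ∀ Z : TDom 3 N, DifferentiableOn ℂ (fun p => act p Z) U)
    (hbound : ∀ p ∈ U, ∀ Z : TDom 3 N, ‖act p Z‖ ≤ A * Real.exp (-(R * torusTreeLen Z.1))) :
    ∃ 𝒯 : Finset (TPt 3 N) → P → ℂ,
      (∀ (Y : Finset (TPt 3 N)) (p p' : P), (∀ Z : TDom 3 N, Z.1 ⊆ Y → act p Z = act p' Z) → 𝒯 Y p = 𝒯 Y p') ∧
      (∀ p ∈ U, ∀ Y : Finset (TPt 3 N), ¬ TFaceConnected Y → 𝒯 Y p = 0) ∧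
      (∀ Y : Finset (TPt 3 N), DifferentiableOn ℂ (𝒯 Y) U) ∧
      (∀ (Y : Finset (TPt 3 N)), ∀ p ∈ U, ‖𝒯 Y p‖ ≤
        Real.exp 1 * (tgeometry 3 N).ν * (tgeometry 3 N).c₁ * (tgeometry 3 N).K₀ ^ 2 * A * Real.exp (-r₁ * torusTreeLen Y)) ∧
      (∀ p ∈ U, (∀ Z : TDom 3 N, (act p Z).im = 0) →
        (∀ Y : Finset (TPt 3 N), (𝒯 Y p).im = 0) ∧
        0 < (polymerPartitionFunction TTouch (act p) (Finset.univ : Finset (TDom 3 N))).re ∧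
        Real.log (polymerPartitionFunction TTouch (act p) (Finset.univ : Finset (TDom 3 N))).re = ∑ Y : Finset (TPt 3 N), (𝒯 Y p).re) :=
  ⟨fun Y p => locE TTouch (fun Z : TDom 3 N => Z.1) (act p) Y,
    fun Y _ _ h => locE_param_congr act Y h,
    fun _ hp _ hY => locE_param_eq_zero_of_not_tFaceConnected act hA hr₁ hrate hsmall (hbound _ hp) hY,
    fun Y => differentiableOn_locE_param_tthree act hU hA hr₁ hrate hsmall hhol hbound Y,
    fun Y _ hp => norm_locE_param_le_tthree act hU hA hr₁ hrate hsmall hhol hbound Y hp,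
    fun _ hp hreal => locE_param_real act hA hr₁ hrate hsmall (hbound _ hp) hreal⟩

end Summit.QuantumFields.YangMills.Theorems.FluctuationComparisonRegPrIntLPolymerMayerGasParam

end
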